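import Literature.AlgebraicGeometry.Resolution.RegularLocalOrder
import Literature.AlgebraicGeometry.Resolution.RegularLocalRingsQuotient
import HarnessLib

/-!
# The e.f.t. local weighted game (H2a′), dim-2 rung, case C I: orders of unit–monomial sums in two parameters

Topic: `Summits/ResolutionOfSingularities/ResolutionOfSingularities/Theorems`. Helper (part 1 of 3 of kernel **K3**
«sub-integral first slope» of res-type-098's design memo `L/res-type-098-w43/EFT-DIM2-DESIGN.md` §2 row C / §4) for
the door item `HypersurfaceCentreConstruction` (statement `stmt-ResolutionOfSingularities-19897`, route
`WeightedInvariant`), line `local-engine` of `res-L1-w43-plan-1` (ORDER (o13), dim-2 rung); second hand res-type-025.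

[OURS · L1 W4.3] Replaces the role of NO printed item; NOT a statement of the manuscript
[claim: Hironaka2017, status: under-review]. AI work, weaker than expert review.

## Content (pure local algebra, no definitions)

(The companion facts «`t ∈ 𝔪` a non-zero-divisor with `R/(t)` regular ⇒ `t ∉ 𝔪²`» and the Nakayama
embedding-dimension lemma are ALREADY in the tree: `EquisingularLiftNat.Sections.not_mem_sq_of_isRegularLocalRing_quotient`
/ `spanFinrank_maximalIdeal_le_of_mem_sq`, module `…EquisingularLiftEquisingularLiftNatPlaneCurveSingular` — cited, not
restated.)

* `mem_sup_span_singleton_iff_mk_mem_map` / `not_mem_pow_sup_iff_mk_not_mem_map_pow` — bookkeeping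
  `z ∈ 𝔪ʲ + (t) ↔ z̄ ∈ 𝔪̄ʲ`;
* **`sum_monomial_not_mem_pow`** — the ORDER COMPUTATION the case-C chart needs: if `(R, 𝔪)` is regular local,
  `z₂ ∈ 𝔪 ∖ 𝔪²` and `z₁ ∈ 𝔪` with `z̄₁ ∉ 𝔪̄²` in `R/(z₂)` (two members of a regular system of parameters), then a
  finite sum `Σ_k v_k z₁^{α_k} z₂^{β_k}` with UNIT coefficients and pairwise distinct exponent pairs does not lie in
  `𝔪^{n+1}`, `n = min_k (α_k + β_k)` — i.e. its order is the least total degree (no cancellation of initial forms).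
  Proof by induction on `n` through `R/(z₂)` (regular, Matsumura 14.2) and the additivity of the order in a regular
  local ring (`mul_not_mem_pow_of_not_mem_pow`, Zariski–Samuel VIII §1 Thm. 1); no associated graded ring, no
  coefficient field.

## References

* H. Matsumura, *Commutative Ring Theory*, Thm. 14.2 (regular local rings modulo a parameter). [Matsumura1987]
* O. Zariski, P. Samuel, *Commutative Algebra* II, Ch. VIII §1 Thm. 1 (order valuation). [ZariskiSamuel1960]
-/

set_option linter.dupNamespace false -- mandated namespace of this single-conjunct summit

namespace Summit.ResolutionOfSingularities.ResolutionOfSingularities.Theorems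

namespace LocalGameEFTSubSlope

open IsLocalRing Literature.AlgebraicGeometry.Resolution

universe u

variable {R : Type u} [CommRing R]

/-! ## Bookkeeping modulo a principal ideal -/

section NotMemSq

/-- Bookkeeping: `z ∈ J + (t)` iff `z̄ ∈ J̄` in `R/(t)` (`J̄` the image of `J`). [folklore] -/
theorem mem_sup_span_singleton_iff_mk_mem_map {t z : R} {J : Ideal R} :
    z ∈ J ⊔ Ideal.span {t} ↔ Ideal.Quotient.mk (Ideal.span {t}) z ∈ J.map (Ideal.Quotient.mk (Ideal.span {t})) := by
  rw [← Ideal.mem_comap, Ideal.comap_map_of_surjective _ Ideal.Quotient.mk_surjective,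
    ← RingHom.ker_eq_comap_bot, Ideal.mk_ker]

/-- `z ∉ 𝔪ʲ + (t)` iff `z̄ ∉ 𝔪̄ʲ`, with `𝔪̄ʲ` written as `(𝔪 R/(t))ʲ = (image of 𝔪)ʲ`. [folklore] -/
theorem not_mem_pow_sup_iff_mk_not_mem_map_pow [IsLocalRing R] {t z : R} {j : ℕ} :
    z ∉ maximalIdeal R ^ j ⊔ Ideal.span {t} ↔
      Ideal.Quotient.mk (Ideal.span {t}) z ∉ ((maximalIdeal R).map (Ideal.Quotient.mk (Ideal.span {t}))) ^ j := by
  rw [← Ideal.map_pow, mem_sup_span_singleton_iff_mk_mem_map]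

end NotMemSq

/-! ## Orders of unit–monomial sums in two independent parameters -/

section MonomialOrder

variable [IsRegularLocalRing R]

/-- One term: `v z₁^α z₂^β ∈ 𝔪^{α+β}` for `z₁, z₂ ∈ 𝔪`. [folklore] -/
theorem monomial_mem_pow {z₁ z₂ : R} (hz₁ : z₁ ∈ maximalIdeal R) (hz₂ : z₂ ∈ maximalIdeal R)
    (v : R) (α β : ℕ) : v * z₁ ^ α * z₂ ^ β ∈ maximalIdeal R ^ (α + β) := by
  rw [pow_add, mul_assoc]
  exact Ideal.mul_mem_left _ v (Ideal.mul_mem_mul (Ideal.pow_mem_pow hz₁ α) (Ideal.pow_mem_pow hz₂ β))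

/-- **Order of a unit–monomial sum in two independent parameters** (kernel K3 of res-type-098's dim-2 design, the
«bidegree computation»): let `(R, 𝔪)` be a regular local ring, `z₂ ∈ 𝔪 ∖ 𝔪²`, `z₁ ∈ 𝔪` with image outside
`𝔪̄²` in `R/(z₂)`; let `Σ_{k ∈ T} v_k z₁^{α_k} z₂^{β_k}` be a finite sum with unit coefficients `v_k` and pairwise
distinct exponent pairs `(α_k, β_k)`, all of total degree `≥ n` and some of total degree `n`. Then the sum is NOT in
`𝔪^{n+1}` (its `𝔪`-adic order is exactly `n`). Induction on `n`: if a term of degree `n` has `β = 0`, reduce modulo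
`z₂` — there the sum is `v̄ z̄₁ⁿ +` (higher powers of `z̄₁`), and `z̄₁ⁿ ∉ 𝔪̄ⁿ⁺¹` in the regular local ring `R/(z₂)`;
otherwise every `β = 0` term has degree `> n`, the rest is `z₂ · Σ'` with `Σ' ∉ 𝔪ⁿ` by induction, and
`z₂ Σ' ∉ 𝔪ⁿ⁺¹` by additivity of the order. [cite: ZariskiSamuel1960, Ch. VIII §1 Thm. 1] -/
theorem sum_monomial_not_mem_pow {z₁ z₂ : R} (hz₁ : z₁ ∈ maximalIdeal R) (hz₂ : z₂ ∈ maximalIdeal R)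
    (hz₂' : z₂ ∉ maximalIdeal R ^ 2)
    (hz₁' : Ideal.Quotient.mk (Ideal.span {z₂}) z₁ ∉
      ((maximalIdeal R).map (Ideal.Quotient.mk (Ideal.span {z₂}))) ^ 2)
    {ι : Type*} (α : ι → ℕ) (v : ι → R) (n : ℕ) (T : Finset ι) (β : ι → ℕ)
    (hinj : Set.InjOn (fun k => (α k, β k)) T) (hv : ∀ k ∈ T, IsUnit (v k))
    (hle : ∀ k ∈ T, n ≤ α k + β k) (hex : ∃ k ∈ T, α k + β k = n) :
    ∑ k ∈ T, v k * z₁ ^ α k * z₂ ^ β k ∉ maximalIdeal R ^ (n + 1) := by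
  classical
  -- the quotient `R̄ = R/(z₂)` is a regular local ring with maximal ideal the image of `𝔪`
  set I : Ideal R := Ideal.span {z₂} with hI
  haveI : Nontrivial (R ⧸ I) := Ideal.Quotient.nontrivial_iff.mpr (Ideal.span_singleton_ne_top hz₂)
  haveI hRbar : IsRegularLocalRing (R ⧸ I) := (IsRegularLocalRing.quotient_span_singleton hz₂ hz₂').1
  have hmbar : maximalIdeal (R ⧸ I) = (maximalIdeal R).map (Ideal.Quotient.mk I) :=
    maximalIdeal_quotient_eq_map I
  have hz₁bar : Ideal.Quotient.mk I z₁ ∉ maximalIdeal (R ⧸ I) ^ (1 + 1) := by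
    rw [hmbar]; exact hz₁'
  induction n generalizing T β with
  | zero =>
    -- a term with `α = β = 0` is a unit, the others lie in `𝔪`
    obtain ⟨k₀, hk₀, hk₀n⟩ := hex
    have hα0 : α k₀ = 0 := by omega
    have hβ0 : β k₀ = 0 := by omega
    rw [zero_add, pow_one, ← Finset.add_sum_erase T _ hk₀, hα0, hβ0, pow_zero, pow_zero, mul_one, mul_one]
    intro hmem
    have hrest : ∑ k ∈ T.erase k₀, v k * z₁ ^ α k * z₂ ^ β k ∈ maximalIdeal R := by
      refine Ideal.sum_mem _ fun k hk => ?_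
      have hkT : k ∈ T := Finset.mem_of_mem_erase hk
      have hne : (α k, β k) ≠ (α k₀, β k₀) := fun h => (Finset.ne_of_mem_erase hk) (hinj hkT hk₀ h)
      have hpos : 0 < α k + β k := by
        rw [hα0, hβ0] at hne
        by_contra h0
        exact hne (by simp only [Prod.mk.injEq]; omega)
      have := monomial_mem_pow hz₁ hz₂ (v k) (α k) (β k)
      exact Ideal.pow_le_self (by omega) this
    have hv0 : v k₀ ∈ maximalIdeal R := by
      have := Ideal.sub_mem _ hmem hrest
      rwa [add_sub_cancel_right] at this
    exact (hv k₀ hk₀) |> fun hu => (IsLocalRing.mem_maximalIdeal _).mp hv0 hu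
  | succ n ih =>
    intro hmem
    -- split off the terms with `β = 0`
    set T₀ := T.filter (fun k => β k = 0) with hT₀
    set T₁ := T.filter (fun k => ¬ β k = 0) with hT₁
    have hsplit := Finset.sum_filter_add_sum_filter_not T (fun k => β k = 0)
      (fun k => v k * z₁ ^ α k * z₂ ^ β k)
    -- the `β ≠ 0` part is `z₂ · Σ'`
    have hT₁eq : ∑ k ∈ T₁, v k * z₁ ^ α k * z₂ ^ β k =
        z₂ * ∑ k ∈ T₁, v k * z₁ ^ α k * z₂ ^ (β k - 1) := by
      rw [Finset.mul_sum]
      refine Finset.sum_congr rfl fun k hk => ?_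
      have hβk : β k ≠ 0 := (Finset.mem_filter.mp hk).2
      obtain ⟨c, hc⟩ := Nat.exists_eq_succ_of_ne_zero hβk
      rw [hc, Nat.succ_sub_one, pow_succ]
      ring
    by_cases hA : ∃ k₀ ∈ T, β k₀ = 0 ∧ α k₀ = n + 1
    · -- Case A: reduce modulo `z₂`
      obtain ⟨k₀, hk₀, hβ0, hα0⟩ := hA
      have hk₀T₀ : k₀ ∈ T₀ := Finset.mem_filter.mpr ⟨hk₀, hβ0⟩
      apply_fun Ideal.Quotient.mk I at hsplit
      have hbar : Ideal.Quotient.mk I (∑ k ∈ T, v k * z₁ ^ α k * z₂ ^ β k) ∈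
          maximalIdeal (R ⧸ I) ^ (n + 1 + 1) := by
        rw [hmbar, ← Ideal.map_pow]
        exact Ideal.mem_map_of_mem _ hmem
      rw [← hsplit, hT₁eq, map_add, map_mul, Ideal.Quotient.eq_zero_iff_mem.mpr (Ideal.mem_span_singleton_self z₂),
        zero_mul, add_zero, map_sum, ← Finset.add_sum_erase T₀ _ hk₀T₀] at hbar
      -- the other `β = 0` terms lie in `𝔪̄^{n+2}`
      have hrest : ∑ k ∈ T₀.erase k₀, Ideal.Quotient.mk I (v k * z₁ ^ α k * z₂ ^ β k) ∈
          maximalIdeal (R ⧸ I) ^ (n + 1 + 1) := by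
        refine Ideal.sum_mem _ fun k hk => ?_
        have hkT₀ : k ∈ T₀ := Finset.mem_of_mem_erase hk
        have hkT : k ∈ T := (Finset.mem_filter.mp hkT₀).1
        have hβk : β k = 0 := (Finset.mem_filter.mp hkT₀).2
        have hne : (α k, β k) ≠ (α k₀, β k₀) := fun h => (Finset.ne_of_mem_erase hk) (hinj hkT hk₀ h)
        have hαk : n + 1 + 1 ≤ α k := by
          have h1 := hle k hkT
          rw [hβk, hβ0] at hne
          rw [hβk] at h1
          have : α k ≠ n + 1 := fun h => hne (by rw [h, hα0])
          omega
        rw [hmbar, ← Ideal.map_pow]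
        refine Ideal.mem_map_of_mem _ ?_
        exact Ideal.pow_le_pow_right hαk (by simpa [hβk] using monomial_mem_pow hz₁ hz₂ (v k) (α k) (β k))
      have hmain : Ideal.Quotient.mk I (v k₀ * z₁ ^ α k₀ * z₂ ^ β k₀) ∈ maximalIdeal (R ⧸ I) ^ (n + 1 + 1) := by
        have := Ideal.sub_mem _ hbar hrest
        rwa [add_sub_cancel_right] at this
      rw [hβ0, hα0, pow_zero, mul_one, map_mul, map_pow] at hmain
      have hu : IsUnit (Ideal.Quotient.mk I (v k₀)) := (hv k₀ hk₀).map _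
      rw [Ideal.unit_mul_mem_iff_mem _ hu] at hmain
      have := pow_not_mem_pow_of_not_mem_pow hz₁bar (n + 1)
      rw [mul_one] at this
      exact this hmain
    · -- Case B: every `β = 0` term has degree `> n + 1`; the minimum is attained on `T₁`
      push Not at hA
      have hT₀mem : ∑ k ∈ T₀, v k * z₁ ^ α k * z₂ ^ β k ∈ maximalIdeal R ^ (n + 1 + 1) := by
        refine Ideal.sum_mem _ fun k hk => ?_
        have hkT : k ∈ T := (Finset.mem_filter.mp hk).1
        have hβk : β k = 0 := (Finset.mem_filter.mp hk).2
        have hαk : n + 1 + 1 ≤ α k := by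
          have h1 := hle k hkT
          have h2 := hA k hkT hβk
          rw [hβk] at h1
          omega
        exact Ideal.pow_le_pow_right hαk (by simpa [hβk] using monomial_mem_pow hz₁ hz₂ (v k) (α k) (β k))
      -- induction hypothesis for `Σ'` over `T₁` with exponents `(α, β - 1)`
      have hinj' : Set.InjOn (fun k => (α k, β k - 1)) T₁ := by
        intro k hk k' hk' h
        have hβk : β k ≠ 0 := (Finset.mem_filter.mp hk).2
        have hβk' : β k' ≠ 0 := (Finset.mem_filter.mp hk').2
        simp only [Prod.mk.injEq] at h
        refine hinj (Finset.mem_filter.mp hk).1 (Finset.mem_filter.mp hk').1 ?_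
        simp only [Prod.mk.injEq]
        omega
      have hv' : ∀ k ∈ T₁, IsUnit (v k) := fun k hk => hv k (Finset.mem_filter.mp hk).1
      have hle' : ∀ k ∈ T₁, n ≤ α k + (β k - 1) := by
        intro k hk
        have hβk : β k ≠ 0 := (Finset.mem_filter.mp hk).2
        have := hle k (Finset.mem_filter.mp hk).1
        omega
      have hex' : ∃ k ∈ T₁, α k + (β k - 1) = n := by
        obtain ⟨k₁, hk₁, hk₁n⟩ := hex
        have hβk₁ : β k₁ ≠ 0 := fun h => hA k₁ hk₁ h (by omega)
        exact ⟨k₁, Finset.mem_filter.mpr ⟨hk₁, hβk₁⟩, by omega⟩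
      have hS' := ih T₁ (fun k => β k - 1) hinj' hv' hle' hex'
      -- `z₂ Σ' ∉ 𝔪^{n+2}`
      have hprod : z₂ * ∑ k ∈ T₁, v k * z₁ ^ α k * z₂ ^ (β k - 1) ∉ maximalIdeal R ^ (n + 1 + 1) := by
        have := mul_not_mem_pow_of_not_mem_pow hz₂' hS'
        rwa [show 1 + n + 1 = n + 1 + 1 by ring] at this
      apply hprod
      rw [← hT₁eq]
      have := Ideal.sub_mem _ hmem hT₀mem
      rwa [← hsplit, add_sub_cancel_left] at this

end MonomialOrder

end LocalGameEFTSubSlope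

end Summit.ResolutionOfSingularities.ResolutionOfSingularities.Theorems
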